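import Summits.Langlands.Langlands.Theses.MonodromyDichotomy

/-!
# Glue of the generation-1 split of `LieIrreducibleAutomorphy` (route MonodromyDichotomy, rev 1)

Closes the glue item `stmt-Langlands-26926` of `route-Langlands-MonodromyDichotomy`:
`LieIrreducibleAutomorphy_of_split : RankTwoLieIrreducibleAutomorphy → SymmetricPowerTransport →
HigherLieRankAutomorphy → LieIrreducibleAutomorphy`.
Pure logic — STRONG INDUCTION on the rank: `n = 2` is the rank-two cell; for `n ≥ 3` the induction
hypothesis is exactly the rank induction hypothesis the two transport items take as input, and excluded
middle on the (inlined) progression-spectra dial selects the symmetric-power cell or the higher-Lie-rank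
cell.  This is the lens-2 node proof `LieRankDichotomy.lieIrreducibleAutomorphy_of_pieces`
(decomp-langlands, 2026-08-30; certified against a mock render in the node's kit check), transported to
the tree's declarations.  No definitions, no new mathematics.
-/

set_option linter.dupNamespace false -- project-wide option; `Summit.Langlands.Langlands` is the mandated namespace

namespace Summit.Langlands.Langlands.Theorems

open Summit.Langlands.Langlands.Theses.MonodromyDichotomy in
/-- The glue item `stmt-Langlands-26926` of route MonodromyDichotomy (rev 1): the three children
`RankTwoLieIrreducibleAutomorphy`, `SymmetricPowerTransport`, `HigherLieRankAutomorphy` of the split of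
`LieIrreducibleAutomorphy` imply the parent.  Proof: strong induction on the rank `n`; at `n = 2` the
rank-two cell applies verbatim; at `n ≥ 3` the induction hypothesis feeds the rank-IH slot of the two
transport cells and excluded middle on the progression-spectra dial picks the cell. -/
theorem LieIrreducibleAutomorphy_of_split_proof :
    Summit.Langlands.Langlands.Theses.MonodromyDichotomy.LieIrreducibleAutomorphy_of_split := by
  intro hA2 hSYM hH K _ _ n
  induction n using Nat.strong_induction_on generalizing K with
  | _ n ih =>
    intro hcpt hn ℓ _ ι ρ hirr hgeo hLie
    by_cases h3 : 3 ≤ n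
    · exact (Classical.em _).elim
        (fun hPS => hSYM K n hcpt h3
          (fun m hm hmn E _ _ hE ℓ' _ ι' σ h₁ h₂ h₃ => ih m hmn E hE hm ℓ' ι' σ h₁ h₂ h₃)
          ℓ ι ρ hirr hgeo hLie hPS)
        (fun hPS => hH K n hcpt h3
          (fun m hm hmn E _ _ hE ℓ' _ ι' σ h₁ h₂ h₃ => ih m hmn E hE hm ℓ' ι' σ h₁ h₂ h₃)
          ℓ ι ρ hirr hgeo hLie hPS)
    · obtain rfl : n = 2 := by omega
      exact hA2 K hcpt ℓ ι ρ hirr hgeo hLie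

end Summit.Langlands.Langlands.Theorems
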